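import Summits.QuantumFields.YangMills.Theorems.AllWindowsColdBoxBoxHighLineOrbitMapBulkSurj
import Summits.QuantumFields.YangMills.Theorems.AllWindowsColdBoxBoxHighLineFPOperatorInverseRows

/-!
# T-S5.4J brick J4 `OrbitMapBulkSurj` from J1 and J2 alone (the row input discharged)
# (LINE-19 S5 ⟨stmt-QuantumFields-24004⟩/⟨24335⟩, LINE-20 U5 ⟨24336⟩; task `Cruxes/BoxWindowHighSU2213/TaskS5Laplace.lean`, planner ym-idea-2 g18)

Width seat `ym-line-sfw-p2-w4` (prover-ym-line-sfw-p2-w4-g27-0), J4 holder.  ✓`orbitMapBulkSurj_of` (Newton–contraction on the block box) with its third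
hypothesis `hrow` supplied by ✓`OrbitMapSurj.fpOperator_inv_row_sq_le` (4i + 4v + 4c-E + 4f-L²): **`orbitMapBulkSurj_of_J1_J2 (hJ1 : OrbitMapJacobianDet)
(hJ2 : OrbitMapContraction) : OrbitMapBulkSurj`**.  The by-name `theorem orbitMapBulkSurj : OrbitMapBulkSurj` is then the one-liner
`orbitMapBulkSurj_of_J1_J2 orbitMapJacobianDet orbitMapContraction` once w3's J1 and w2's J2 land.

Everything proved; no definitions; standard axioms.  HONEST LABEL: a CONDITIONAL brick (hypotheses J1, J2) of step (1b)/(1c) of the XL stubs S5/U5 of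
critic-PASSed DRAFT lines on the R2ξ″ cruxes; T-S5.4J, S5, U5 and the items ⟨24004⟩ ⟨24335⟩ ⟨24336⟩ remain OPEN; no stub is closed by name, no crux,
rung or summit is proved; the Yang–Mills mass gap is NOT proved by this file.
-/

set_option autoImplicit false

namespace Summit.QuantumFields.YangMills.Theorems.AllWindowsColdBoxBoxHighLine

/-- **J4 from J1 and J2**: surjectivity of the orbit map from the `a`-block box onto the `ρ`-ball, given the Jacobian brick J1 (differentiability) and the
contraction brick J2; the ℓ² row bound of `F_V⁻¹` is the tree's ✓`OrbitMapSurj.fpOperator_inv_row_sq_le`. -/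
theorem orbitMapBulkSurj_of_J1_J2 (hJ1 : OrbitMapJacobianDet) (hJ2 : OrbitMapContraction) : OrbitMapBulkSurj :=
  orbitMapBulkSurj_of hJ1 hJ2 OrbitMapSurj.fpOperator_inv_row_sq_le

end Summit.QuantumFields.YangMills.Theorems.AllWindowsColdBoxBoxHighLine
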